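import Summits.HodgeConjecture.HodgeConjecture.Theorems.R90S6EtaOneGraphExists            -- ★ W10-a (E.1)–(E.3) `etaOneGraph_partner_exists` ∕ `_unique` ∕ `_existsUnique`
import HarnessLib

/-!
# R90 · S6 «Ch. 14.1–14.5 stable TF» — WAVE 10 card W10-a (E.4): THE TWISTED-ENDOSCOPIC TRANSFER `η̂₁ : ℋ(GL₃(K), GL₃(𝒪)) →ₐ[ℂ] ℋ(U(J₀,2)(E_w), K₀)`
# IN GRAPH CURRENCY — the partner and its packaging as a `ℂ`-algebra homomorphism, API module (`Theorems/R90S6EtaOneGraphPartner.lean`; DAG r5 row E1.4.4.1.2)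

Cell `hodgecm-mathlib`, crux H413 (`stmt-HodgeConjecture-24833`), route of record `HCCMUnconditional`; programme R90-TF, section S6 (base `R90-C14`),
seat R90-C14-p06 (g0); S6 dealer R90-C14-plan (g2) NEW CARD W10-a (R90 bus 2026-09-05T00:05:16Z «row E1.4.4.1.2 THE η̂-MAPS IN GRAPH CURRENCY … math
buildable now exactly like ★ W3–W5»); census of record `R90/R90-C14-p06/g0/CENSUS-W10a.v1.md` (R90 bus, p06 STEP 1).  Dealer rulings R1–R3 (R90 bus 2026-09-05T00:09:50Z): this file = the API MODULE (definition
lane: two `noncomputable def`s + their `rfl` ∕ alg-hom laws; API-module exception as for ★ p09's template); CLONE, name for name, of §2–§3 of ★ p09 (g0)'s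
`Theorems/R90S6BCGraphPartner.lean` (W7-b (ii), `ψ̂_G`) with the unitary side at `N = 2`, over ★ (E.1)–(E.3) `Theorems/R90S6EtaOneGraphExists.lean`.  Lane `--supports stmt-HodgeConjecture-24833 --as helper`;
definition lane (two `noncomputable def`s: the partner and its `→ₐ[ℂ]` packaging — D-0009 review + async audit); imports = ★ S6 Theorems modules + HarnessLib,
no `Cruxes` import.

THE PRINT [Rogawski1990, §4.7 p. 48; §4.10 pp. 56–58].  `G = U(3)`, `H = U(2) × U(1)`, `G̃ = Res_{E∕F} GL₃`; at an inert unramified `w ∣ v` the L-embedding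
`η₁ : ᴸH → ᴸG̃` (§4.7, case `a ≢ b (mod 2)`: `η₁(w) = 1 × w` on `W_E` — NO character `μ`) is unramified and defines `η̂₁ : ℋ(G̃, ω̃) → ℋ(H, ω)` (p. 57); Prop. 4.10.1 (b):
`Δ̃(δ) Φ^κ_ε(δ, φ) = Φ^{st}(γ, η̂₁ φ)` for `φ ∈ ℋ̃` (the twisted-endoscopic FUNDAMENTAL LEMMA, [BR₁]); Prop. 4.10.2 p. 58: for every unramified character `χ` of
the diagonal torus `M = {d(a, b, ā⁻¹)}` and `π̃ = i_{G̃}(χ ∘ N)`, `Tr(π̃(φ) π̃(ε)) = Tr(i_H(χ)(η̂₁ φ))` — with the SAME `χ` on both sides (`π̃(ε)` fixes the spherical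
line, so the twisted trace of `φ ∈ ℋ̃` is its Hecke eigenvalue).  In torus-parameter letters (`χ = χ_z`, `z = χ(d(ϖ, 1, ϖ⁻¹))`): `χ_z ∘ N` has `GL₃`-parameter
`(z, 1, z⁻¹)` (p. 58: `N(d(x, y, z′)) = d(x∕z̄′, y∕ȳ, z′∕x̄)`), and `i_H(χ_z) = i_{U(Φ₂)}(χ_z) ⊗ 𝟙_{U(1)}` has `U(J₀,2)`-parameter `(z, 1)` (the `U(1)`-factor is
compact, `ℋ(U(1)_v, U(1)_v) = ℂ`, dropped as in FILE D's `SatakeGraph`).  HENCE THE GRAPH OF `η̂₁` IS UNSIGNED: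
`GraphBCEta₁ φ fH :⟺ ∀ z ∈ ℂˣ, λ^{GL₃}_{(z,1,z⁻¹)}(φ) = λ^{U(J₀,2)}_{(z,1)}(fH)` — contrast FILE D's `SatakeGraph` for `ξ̂_H` (`(φ^H)^∧(z) = φ^∧(−z)`: there `μ = χ_{−1}`
enters through `ξ_H|_{W_E}`), so `η̂₁ ≠ ξ̂_H ∘ ψ̂_G` on spherical algebras — they differ by the involution `z ↦ −z` of `ℋ(U(J₀,2)) = ℂ[T₁]`.
CURRENCY = ★ p09's: `GL₃` side `(isIwasawaExponent_gl (n := 3) hϖ).heckeEigencharacter wt (laurentMonomialHom ![z, 1, z⁻¹]) φ` over ANY discretely valued `K`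
(= FILE D's `glHeckeEigencharUnit L v w (rogawskiParamBC z) φ` by `rfl` at `K = L_w`, junction probe in ★ W7-b (i)); `U(J₀,2)` side ★
`unitaryHeckeEigencharacterAdic c hc1 v w hw hv ![z, 1] fH` (= FILE D's `rogawskiParamH z` by `rfl`).

* `etaOneGraphPartner φ` (`Classical.choose`) with `etaOneGraphPartner_graph`, `eq_etaOneGraphPartner_of_graph`, `_one`, `_zero`, `_mul`, `_add`, `_smul`, `_algebraMap`;
* **`etaOneGraphPartnerAlgHom : ℋ(GL₃(K), GL₃(𝒪)) →ₐ[ℂ] ℋ(U(J₀,2)(E_w), K₀)`** = print's `η̂₁` as a `ℂ`-algebra homomorphism, `graph_etaOneGraphPartnerAlgHom`,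
  `eq_etaOneGraphPartnerAlgHom_of_graph`, `etaOneGraphPartnerAlgHom_one` (unit ↦ unit).
The pins at `K = L_𝔴` (`hϖ`, `hu`, the DVR ∕ finite-residue-field ∕ Hecke-pair instances) are ★ p09's §4 [Theorems/R90S6BCGraphPartner.lean :257–:292] — not restated.

HONEST LABEL: local spherical Hecke-algebra bookkeeping; proves no printed global statement and NOT the fundamental lemma Prop. 4.10.1 (b) itself (that is the
E1.4.4.5b socket, deferred); count-neutral until E1.4.4.3.x ∕ E1.4.4.5b consume `GraphBCEta₁`.  HC_CM is proved only modulo the 7 printed citations (2 remaining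
named inputs: hLiu418 = stmt-HodgeConjecture-24832, h413 = stmt-HodgeConjecture-24833) until rung 0 closes; REL ≠ ★ ≠ BUILT.

## References
* [Rogawski1990] J. D. Rogawski, *Automorphic Representations of Unitary Groups in Three Variables*, Ann. of Math. Stud. 123 (1990), §4.7 p. 48 (`η₁`, `η₂`),
  §4.10 pp. 56–58 (Prop. 4.10.1 (b), Prop. 4.10.2), §4.9 p. 55.
* [CartierCorvallis1979] P. Cartier, *Representations of 𝔭-adic groups: a survey*, PSPM 33.1 (1979), §IV (4.2)–(4.4), Thm. 4.1, Cor. 4.2.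
-/

set_option autoImplicit false
-- the mandated namespace repeats the single-problem summit's segment (`HodgeConjecture.HodgeConjecture`)
set_option linter.dupNamespace false

noncomputable section

open NumberField IsDedekindDomain
open Literature.NumberTheory.Automorphic Literature.NumberTheory.Automorphic.HermitianLattice Literature.NumberTheory.Automorphic.UnitaryGroup
open scoped MatrixGroups
open ValuativeRel

namespace Summit.HodgeConjecture.HodgeConjecture.R90.S6

universe u

section Partner

variable {F E : Type} [Field F] [NumberField F] [Field E] [NumberField E] [Algebra F E] [Algebra.IsQuadraticExtension F E]
  (c : E ≃ₐ[F] E) (hc1 : c ≠ 1) (v : HeightOneSpectrum (𝓞 F)) (w : PlacesOver E v) (hw : c • w.1 = w.1)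
  (hv : Algebra.IsUnramifiedIn (𝓞 E) v.asIdeal)
  {K : Type u} [Field K] [ValuativeRel K] [IsDiscreteValuationRing 𝒪[K]] [Finite 𝓀[K]] {ϖ : K}
  [IsHeckeTriple (⊤ : Submonoid (GL (Fin 3) K)) (glInt 3 K) (glInt 3 K)]
  (hϖ : IsUniformizingElement ϖ) {u : ℂˣ} (hu : (u : ℂ) ^ 2 = ((Nat.card 𝓀[K] : ℕ) : ℂ))
  {wt : Multiplicative (Fin 3 → ℤ) →* ℂ}
  (hwt : ∀ e : Fin 3 → ℤ, wt (Multiplicative.ofAdd e) = ((u ^ ((((3 : ℕ) : ℤ) - 1) * (∑ i, e i) - 2 * satakeTwistExp e) : ℂˣ) : ℂ))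

include hu hwt

/-! ## §2 The partner `η̂₁(φ)` and its laws -/

/-- **The η̂₁-graph partner `η̂₁(φ)`** [Rogawski1990, §4.10 p. 57]: for `φ ∈ ℋ(GL₃(K), GL₃(𝒪))`, THE element
`η̂₁(φ) ∈ ℋ(U(J₀,2)(E_w), K₀)` with `λ^{U(J₀,2)}_{(z,1)}(η̂₁ φ) = λ^{GL₃}_{(z,1,z⁻¹)}(φ)` for all `z ∈ ℂˣ` (exists by `etaOneGraph_partner_exists`,
unique by `etaOneGraph_partner_unique`; chosen with `Classical.choose`). [cite: Rogawski1990, §4.10 Prop. 4.10.1 (b) pp. 57–58] -/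
noncomputable def etaOneGraphPartner (φ : heckeAlgebra ℂ (GL (Fin 3) K) (glInt 3 K)) :
    heckeAlgebra ℂ ↥(unitaryGroupOfForm (galAdicCompletionMap (L := E) c hw) ((StdForm.antidiagonal 2).over (w.1.adicCompletion E)))
      (unitaryInt (galAdicCompletionMap (L := E) c hw) ((StdForm.antidiagonal 2).over (w.1.adicCompletion E))) :=
  (etaOneGraph_partner_exists c hc1 v w hw hv hϖ hu hwt φ).choose

/-- **The graph relation of `η̂₁(φ)`** (the (D ED. 6) predicate `GraphBCEta₁ φ (η̂₁ φ)`, orientation `GL₃ = U(J₀,2)`): `λ^{GL₃}_{(z,1,z⁻¹)}(φ) =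
λ^{U(J₀,2)}_{(z,1)}(η̂₁ φ)` for every `z ∈ ℂˣ`. [cite: Rogawski1990, §4.10 Prop. 4.10.2 p. 58] -/
theorem etaOneGraphPartner_graph (φ : heckeAlgebra ℂ (GL (Fin 3) K) (glInt 3 K)) (z : ℂˣ) :
    (isIwasawaExponent_gl (n := 3) hϖ).heckeEigencharacter wt (laurentMonomialHom ![z, 1, z⁻¹]) φ =
      unitaryHeckeEigencharacterAdic c hc1 v w hw hv ![z, 1] (etaOneGraphPartner c hc1 v w hw hv hϖ hu hwt φ) :=
  (etaOneGraph_partner_exists c hc1 v w hw hv hϖ hu hwt φ).choose_spec z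

/-- **Characterisation**: any `f` in η̂₁-graph position with `φ` IS `η̂₁(φ)`. [cite: Rogawski1990, §4.10 p. 57]
[cite: CartierCorvallis1979, §IV Cor. 4.2] -/
theorem eq_etaOneGraphPartner_of_graph (φ : heckeAlgebra ℂ (GL (Fin 3) K) (glInt 3 K))
    (f : heckeAlgebra ℂ ↥(unitaryGroupOfForm (galAdicCompletionMap (L := E) c hw) ((StdForm.antidiagonal 2).over (w.1.adicCompletion E)))
      (unitaryInt (galAdicCompletionMap (L := E) c hw) ((StdForm.antidiagonal 2).over (w.1.adicCompletion E))))
    (h : ∀ z : ℂˣ, (isIwasawaExponent_gl (n := 3) hϖ).heckeEigencharacter wt (laurentMonomialHom ![z, 1, z⁻¹]) φ =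
      unitaryHeckeEigencharacterAdic c hc1 v w hw hv ![z, 1] f) :
    f = etaOneGraphPartner c hc1 v w hw hv hϖ hu hwt φ :=
  etaOneGraph_partner_unique c hc1 v w hw hv hϖ φ f _ h (etaOneGraphPartner_graph c hc1 v w hw hv hϖ hu hwt φ)

/-- `η̂₁(1) = 1` (both unit elements have all eigenvalues `1`: the unit pair of the base-change fundamental lemma is in graph
position). [cite: Rogawski1990, §4.10 Prop. 4.10.1 (b) p. 57] -/
theorem etaOneGraphPartner_one : etaOneGraphPartner c hc1 v w hw hv hϖ hu hwt 1 = 1 :=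
  (eq_etaOneGraphPartner_of_graph c hc1 v w hw hv hϖ hu hwt 1 1 fun _ => Eq.trans (map_one _) (Eq.symm (map_one _))).symm

/-- `η̂₁(0) = 0`. [cite: Rogawski1990, §4.10 p. 57] -/
theorem etaOneGraphPartner_zero : etaOneGraphPartner c hc1 v w hw hv hϖ hu hwt 0 = 0 :=
  (eq_etaOneGraphPartner_of_graph c hc1 v w hw hv hϖ hu hwt 0 0 fun _ => Eq.trans (map_zero _) (Eq.symm (map_zero _))).symm

/-- `η̂₁(φ ψ) = η̂₁(φ) η̂₁(ψ)` (the eigencharacters are multiplicative). [cite: Rogawski1990, §4.10 p. 57] -/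
theorem etaOneGraphPartner_mul (φ ψ : heckeAlgebra ℂ (GL (Fin 3) K) (glInt 3 K)) :
    etaOneGraphPartner c hc1 v w hw hv hϖ hu hwt (φ * ψ) =
      etaOneGraphPartner c hc1 v w hw hv hϖ hu hwt φ * etaOneGraphPartner c hc1 v w hw hv hϖ hu hwt ψ :=
  (eq_etaOneGraphPartner_of_graph c hc1 v w hw hv hϖ hu hwt (φ * ψ) _ fun z => Eq.trans (map_mul _ _ _) (Eq.trans
    (congrArg₂ (· * ·) (etaOneGraphPartner_graph c hc1 v w hw hv hϖ hu hwt φ z) (etaOneGraphPartner_graph c hc1 v w hw hv hϖ hu hwt ψ z))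
    (Eq.symm (map_mul _ _ _)))).symm

/-- `η̂₁(φ + ψ) = η̂₁(φ) + η̂₁(ψ)` (the eigencharacters are additive). [cite: Rogawski1990, §4.10 p. 57] -/
theorem etaOneGraphPartner_add (φ ψ : heckeAlgebra ℂ (GL (Fin 3) K) (glInt 3 K)) :
    etaOneGraphPartner c hc1 v w hw hv hϖ hu hwt (φ + ψ) =
      etaOneGraphPartner c hc1 v w hw hv hϖ hu hwt φ + etaOneGraphPartner c hc1 v w hw hv hϖ hu hwt ψ := by
  refine (eq_etaOneGraphPartner_of_graph c hc1 v w hw hv hϖ hu hwt (φ + ψ) _ fun z => ?_).symm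
  have h₁ := ((isIwasawaExponent_gl (n := 3) hϖ).heckeEigencharacter wt (laurentMonomialHom ![z, 1, z⁻¹])).toRingHom.map_add φ ψ
  have h₂ := (unitaryHeckeEigencharacterAdic c hc1 v w hw hv ![z, 1]).toRingHom.map_add
    (etaOneGraphPartner c hc1 v w hw hv hϖ hu hwt φ) (etaOneGraphPartner c hc1 v w hw hv hϖ hu hwt ψ)
  exact h₁.trans ((congrArg₂ (· + ·) (etaOneGraphPartner_graph c hc1 v w hw hv hϖ hu hwt φ z)
    (etaOneGraphPartner_graph c hc1 v w hw hv hϖ hu hwt ψ z)).trans h₂.symm)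

/-- `η̂₁(r • φ) = r • η̂₁(φ)` for `r ∈ ℂ` (the eigencharacters are `ℂ`-linear). [cite: Rogawski1990, §4.10 p. 57] -/
theorem etaOneGraphPartner_smul (r : ℂ) (φ : heckeAlgebra ℂ (GL (Fin 3) K) (glInt 3 K)) :
    etaOneGraphPartner c hc1 v w hw hv hϖ hu hwt (r • φ) = r • etaOneGraphPartner c hc1 v w hw hv hϖ hu hwt φ := by
  refine (eq_etaOneGraphPartner_of_graph c hc1 v w hw hv hϖ hu hwt (r • φ) _ fun z => ?_).symm
  have h₁ := ((isIwasawaExponent_gl (n := 3) hϖ).heckeEigencharacter wt (laurentMonomialHom ![z, 1, z⁻¹])).toLinearMap.map_smul r φ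
  have h₂ := (unitaryHeckeEigencharacterAdic c hc1 v w hw hv ![z, 1]).toLinearMap.map_smul r
    (etaOneGraphPartner c hc1 v w hw hv hϖ hu hwt φ)
  exact h₁.trans ((congrArg (r • ·) (etaOneGraphPartner_graph c hc1 v w hw hv hϖ hu hwt φ z)).trans h₂.symm)

/-- `η̂₁(r · 1) = r · 1` for `r ∈ ℂ`: the partner map commutes with the structure maps `ℂ → ℋ` (the `commutes'` field below).
[cite: Rogawski1990, §4.10 p. 57] -/
theorem etaOneGraphPartner_algebraMap (r : ℂ) :
    etaOneGraphPartner c hc1 v w hw hv hϖ hu hwt (algebraMap ℂ _ r) = algebraMap ℂ _ r :=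
  (eq_etaOneGraphPartner_of_graph c hc1 v w hw hv hϖ hu hwt (algebraMap ℂ _ r) (algebraMap ℂ _ r) fun _ =>
    Eq.trans (AlgHom.commutes _ _) (Eq.symm (AlgHom.commutes _ _))).symm

/-! ## §3 `η̂₁` as a `ℂ`-algebra homomorphism -/

/-- **The twisted-endoscopic transfer `η̂₁ : ℋ(GL₃(K), GL₃(𝒪)) →ₐ[ℂ] ℋ(U(J₀,2)(E_w), K₀)` as a `ℂ`-algebra homomorphism** [Rogawski1990, §4.10
p. 57 «define homomorphisms … `η̂₁ : ℋ(G̃, ω̃) → ℋ(H, ω)`»]; its underlying function is `etaOneGraphPartner`.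
[cite: Rogawski1990, §4.10 Prop. 4.10.1 (b) pp. 57–58] [cite: CartierCorvallis1979, §IV Thm. 4.1, Cor. 4.2] -/
noncomputable def etaOneGraphPartnerAlgHom :
    heckeAlgebra ℂ (GL (Fin 3) K) (glInt 3 K) →ₐ[ℂ]
      heckeAlgebra ℂ ↥(unitaryGroupOfForm (galAdicCompletionMap (L := E) c hw) ((StdForm.antidiagonal 2).over (w.1.adicCompletion E)))
        (unitaryInt (galAdicCompletionMap (L := E) c hw) ((StdForm.antidiagonal 2).over (w.1.adicCompletion E))) where
  toFun := etaOneGraphPartner c hc1 v w hw hv hϖ hu hwt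
  map_one' := etaOneGraphPartner_one c hc1 v w hw hv hϖ hu hwt
  map_mul' := etaOneGraphPartner_mul c hc1 v w hw hv hϖ hu hwt
  map_zero' := etaOneGraphPartner_zero c hc1 v w hw hv hϖ hu hwt
  map_add' := etaOneGraphPartner_add c hc1 v w hw hv hϖ hu hwt
  commutes' := etaOneGraphPartner_algebraMap c hc1 v w hw hv hϖ hu hwt

/-- `η̂₁ φ = etaOneGraphPartner φ` (definitional). [cite: Rogawski1990, §4.10 p. 57] -/
theorem etaOneGraphPartnerAlgHom_apply (φ : heckeAlgebra ℂ (GL (Fin 3) K) (glInt 3 K)) :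
    etaOneGraphPartnerAlgHom c hc1 v w hw hv hϖ hu hwt φ = etaOneGraphPartner c hc1 v w hw hv hϖ hu hwt φ :=
  rfl

/-- **The graph law for the hom** (the form the E1.4.4.1.1 ∕ (E1-d) `GraphBCEta₁` consumers read): `λ^{GL₃}_{(z,1,z⁻¹)}(φ) =
λ^{U(J₀,2)}_{(z,1)}(η̂₁ φ)` for every `z ∈ ℂˣ`. [cite: Rogawski1990, §4.10 Prop. 4.10.2 p. 58] -/
theorem graph_etaOneGraphPartnerAlgHom (φ : heckeAlgebra ℂ (GL (Fin 3) K) (glInt 3 K)) (z : ℂˣ) :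
    (isIwasawaExponent_gl (n := 3) hϖ).heckeEigencharacter wt (laurentMonomialHom ![z, 1, z⁻¹]) φ =
      unitaryHeckeEigencharacterAdic c hc1 v w hw hv ![z, 1] (etaOneGraphPartnerAlgHom c hc1 v w hw hv hϖ hu hwt φ) :=
  etaOneGraphPartner_graph c hc1 v w hw hv hϖ hu hwt φ z

/-- **Uniqueness in hom form**: any `f` in η̂₁-graph position with `φ` IS `η̂₁(φ)`.
[cite: Rogawski1990, §4.10 p. 57] [cite: CartierCorvallis1979, §IV Cor. 4.2] -/
theorem eq_etaOneGraphPartnerAlgHom_of_graph (φ : heckeAlgebra ℂ (GL (Fin 3) K) (glInt 3 K))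
    (f : heckeAlgebra ℂ ↥(unitaryGroupOfForm (galAdicCompletionMap (L := E) c hw) ((StdForm.antidiagonal 2).over (w.1.adicCompletion E)))
      (unitaryInt (galAdicCompletionMap (L := E) c hw) ((StdForm.antidiagonal 2).over (w.1.adicCompletion E))))
    (h : ∀ z : ℂˣ, (isIwasawaExponent_gl (n := 3) hϖ).heckeEigencharacter wt (laurentMonomialHom ![z, 1, z⁻¹]) φ =
      unitaryHeckeEigencharacterAdic c hc1 v w hw hv ![z, 1] f) :
    f = etaOneGraphPartnerAlgHom c hc1 v w hw hv hϖ hu hwt φ :=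
  eq_etaOneGraphPartner_of_graph c hc1 v w hw hv hϖ hu hwt φ f h

/-- **Unit ↦ unit**: `η̂₁(1_{K̃}) = 1_{K}`. [cite: Rogawski1990, §4.10 Prop. 4.10.1 (b) p. 57] -/
theorem etaOneGraphPartnerAlgHom_one : etaOneGraphPartnerAlgHom c hc1 v w hw hv hϖ hu hwt 1 = 1 :=
  etaOneGraphPartner_one c hc1 v w hw hv hϖ hu hwt

end Partner

end Summit.HodgeConjecture.HodgeConjecture.R90.S6

end
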